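import Literature.AlgebraicGeometry.Frobenioids.EquivalenceFrobeniusQuasiIsotropicOfPreSteps
import Literature.AlgebraicGeometry.Frobenioids.EquivalencePreStepsQuasiIsotropicFSMFF2024
import Literature.AlgebraicGeometry.Frobenioids.EquivalenceThm34Assembly
import HarnessLib

/-!
# Frobenioids I, Theorem 3.4 (iii) AS TYPED from Theorem 3.4 (ii) — and over bases of FSMFF-type in the
# author's revised (2024) sense; the degree clause of Theorem 3.4 (iv) modulo the unit clause

Mochizuki, *The geometry of Frobenioids I: the general theory*, Kyushu J. Math. **62** (2008)
293–400, Thm. 3.4 (iii)/(iv), kurims pp. 62–63, proof pp. 64–67 [cite: MochizukiFrdI2008, Thm. 3.4 (iii) p.62];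
condition (b) of "FSMFF-type" as revised by the author (*Comments*, January 2024, item (28))
[cite: MochizukiFrdIComments2024, (28) p.3].

PROOF-ONLY file (seat abc-iut-L1-t11; plan/GAP-LEDGER.md row G-L1d8-1 = sub-DAG residual
`FrdI:Thm3.4(iii)/R2`, the printed generality "bases of FSMFF-type" of Thm. 3.4 (iii)–(v), which the cell
had kernel-closed over bases of FSM-type only: `FrdI.thm34iii_ofFunctor_of_isOfFSMType`, seats
abc-iut-L1-t13 / w4-d088 / w4-d033). Assembly of the group-like / non-group-like dichotomy exactly as in
abc-iut-w4-d033's `EquivalenceThm34Assembly.lean`, with the FSM input replaced by the conclusion of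
Thm. 3.4 (ii) for `Ψ` and `Ψ⁻¹`:
* `FrdI.OfPreSteps.thm34iii_ofFunctor` — **(ii) for `Ψ` and `Ψ⁻¹` ⟹ (iii) AS TYPED**: the typed statement
  `PreFrobenioidData.Thm34iii` (abc-iut-L1-t3) holds for every pair of Frobenioids `C_i → F_{Φ_i}` and every
  `Ψ` such that `Ψ`, `Ψ⁻¹` preserve pre-steps and group-like objects (non-group-like case:
  `FrdI.OfPreSteps.thm34iii_morphisms`; group-like case: `FrdI.thm34iii_of_isOfGroupLikeType_of_hypB`, no
  base hypothesis);
* `FrdI.thm34iii_ofFunctor_of_isOfFSMFFType2024` — **Thm. 3.4 (iii) AS TYPED holds over bases of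
  FSMFF-type in the revised sense** (`IsOfFSMFFType2024`, ⊋ FSM-type), i.e. as the author now states it,
  (ii) being `FrdI.thm34ii_of_isOfFSMFFType2024` (abc-iut-L1-t11, the printed route through the revised
  Prop. 1.14 (iii));
* `FrdI.preservesDegFr_ofFunctor_of_isOfFSMFFType2024` — the clause "`Ψ^{ℕ≥1}` is the identity" of
  `PreFrobenioidData.Thm34iv` over such bases modulo only its clause "`Ψ` preserves `O^×(−)`" (`hU`).
Over FSMFF-type bases in the 2008 wording that are not FSMFF-type (revised) nothing is claimed (there the
printed route is broken, PR-1). No statement of the paper is restated or strengthened.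
-/

namespace Literature.AlgebraicGeometry.Frobenioids

namespace FrdI

open CategoryTheory PreFrobenioidData

universe w v v' u u'

variable {D₁ : Type u} [Category.{v} D₁] {Φ₁ : D₁ᵒᵖ ⥤ CommMonCat.{w}} {C₁ : Type u'} [Category.{v'} C₁]
  {D₂ : Type u} [Category.{v} D₂] {Φ₂ : D₂ᵒᵖ ⥤ CommMonCat.{w}} {C₂ : Type u'} [Category.{v'} C₂]
  {F₁ : C₁ ⥤ ElemFrobenioid Φ₁} {F₂ : C₂ ⥤ ElemFrobenioid Φ₂}

namespace OfPreSteps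

/-- **Dichotomy.** If `Ψ` and `Ψ⁻¹` preserve group-like objects (Thm. 3.4 (ii), third clause), either
both `C₁`, `C₂` are of group-like type or both admit a non-group-like object.
[cite: MochizukiFrdI2008, Thm. 3.4 (ii) p.62] -/
theorem groupLike_dichotomy (Ψ : C₁ ≌ C₂)
    (hG : PreservesObj Ψ.functor (ofFunctor Φ₁ F₁).IsGroupLikeObj (ofFunctor Φ₂ F₂).IsGroupLikeObj)
    (hG' : PreservesObj Ψ.inverse (ofFunctor Φ₂ F₂).IsGroupLikeObj (ofFunctor Φ₁ F₁).IsGroupLikeObj) :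
    ((ofFunctor Φ₁ F₁).IsOfGroupLikeType ∧ (ofFunctor Φ₂ F₂).IsOfGroupLikeType) ∨
      ((∃ A : C₁, ¬ (ofFunctor Φ₁ F₁).IsGroupLikeObj A) ∧ ∃ A : C₂, ¬ (ofFunctor Φ₂ F₂).IsGroupLikeObj A) := by
  -- reflection of group-likeness along `Ψ` and `Ψ⁻¹`
  have r₁ : ∀ A : C₁, (ofFunctor Φ₂ F₂).IsGroupLikeObj (Ψ.functor.obj A) → (ofFunctor Φ₁ F₁).IsGroupLikeObj A :=
    fun A hA => (ofFunctor_isGroupLikeObj F₁ A).2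
      (PreFrobenioid.IsGroupLikeObj.of_iso F₁ (Ψ.unitIso.app A).symm
        ((ofFunctor_isGroupLikeObj F₁ _).1 (hG' hA)))
  have r₂ : ∀ B : C₂, (ofFunctor Φ₁ F₁).IsGroupLikeObj (Ψ.inverse.obj B) → (ofFunctor Φ₂ F₂).IsGroupLikeObj B :=
    fun B hB => (ofFunctor_isGroupLikeObj F₂ B).2
      (PreFrobenioid.IsGroupLikeObj.of_iso F₂ (Ψ.counitIso.app B)
        ((ofFunctor_isGroupLikeObj F₂ _).1 (hG hB)))
  by_cases hg : (ofFunctor Φ₁ F₁).IsOfGroupLikeType ∧ (ofFunctor Φ₂ F₂).IsOfGroupLikeType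
  · exact Or.inl hg
  · right
    rw [not_and_or, PreFrobenioidData.isOfGroupLikeType_iff, PreFrobenioidData.isOfGroupLikeType_iff,
      not_forall, not_forall] at hg
    rcases hg with ⟨A, hA⟩ | ⟨B, hB⟩
    · exact ⟨⟨A, hA⟩, ⟨Ψ.functor.obj A, fun h' => hA (r₁ A h')⟩⟩
    · exact ⟨⟨Ψ.inverse.obj B, fun h' => hB (r₂ B h')⟩, ⟨B, hB⟩⟩

/-- **Theorem 3.4 (ii) ⟹ Theorem 3.4 (iii) AS TYPED.** For Frobenioids `C_i → F_{Φ_i}` and an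
equivalence `Ψ` such that `Ψ` and `Ψ⁻¹` preserve pre-steps and group-like objects (the conclusion of
`PreFrobenioidData.Thm34ii` for `Ψ` and for `Ψ⁻¹`, first and third clauses), the typed statement
`PreFrobenioidData.Thm34iii` holds: (a) standard type, (b) `HypB` ⟹ the seven preservation clauses and
the automorphism `Ψ^{ℕ≥1}` (the identity as soon as non-group-like objects exist). Of standard type only
(a) quasi-isotropic and (e) non-dilating are used; NO hypothesis on the base categories.
[cite: MochizukiFrdI2008, Thm. 3.4 (iii) p.62] -/
theorem thm34iii_ofFunctor (hF₁ : PreFrobenioid.IsFrobenioid F₁) (hF₂ : PreFrobenioid.IsFrobenioid F₂)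
    (Ψ : C₁ ≌ C₂)
    (h₁₂ : PreservesMor Ψ.functor (ofFunctor Φ₁ F₁).IsPreStep (ofFunctor Φ₂ F₂).IsPreStep)
    (h₂₁ : PreservesMor Ψ.inverse (ofFunctor Φ₂ F₂).IsPreStep (ofFunctor Φ₁ F₁).IsPreStep)
    (hG : PreservesObj Ψ.functor (ofFunctor Φ₁ F₁).IsGroupLikeObj (ofFunctor Φ₂ F₂).IsGroupLikeObj)
    (hG' : PreservesObj Ψ.inverse (ofFunctor Φ₂ F₂).IsGroupLikeObj (ofFunctor Φ₁ F₁).IsGroupLikeObj) :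
    (ofFunctor Φ₁ F₁).Thm34iii (ofFunctor Φ₂ F₂) Ψ := fun hs₁ hs₂ hB => by
  rcases groupLike_dichotomy Ψ hG hG' with ⟨hg₁, hg₂⟩ | ⟨hN₁, hN₂⟩
  · exact thm34iii_of_isOfGroupLikeType_of_hypB hF₁ hF₂ hs₁.quasiIsotropic hs₂.quasiIsotropic hg₁ hg₂ Ψ hB
  · obtain ⟨hlist, ΨN, hΨN, hid⟩ := thm34iii_morphisms hF₁ hF₂ hs₁.quasiIsotropic
      hs₂.quasiIsotropic hs₁.nonDilating hs₂.nonDilating Ψ h₁₂ h₂₁ hN₁ hN₂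
    exact ⟨hlist, ΨN, hΨN, fun _ _ => hid⟩

/-- **Theorem 3.4 (ii) ⟹ the clause "`Ψ^{ℕ≥1}` is the identity" of Theorem 3.4 (iv), modulo the clause
"`Ψ` preserves `O^×(−)`" of the same theorem** (`hU`, sub-DAG row `(iv)/L08`): under (a) standard type
and (b) `HypB`, if `Ψ`, `Ψ⁻¹` preserve pre-steps and group-like objects, `Ψ` preserves all Frobenius
degrees (non-group-like case: `FrdI.OfPreSteps.degFr_map`; group-like case: the Frobenius-compact
argument `FrdI.preservesDegFr_ofFunctor_of_isOfGroupLikeType`). [cite: MochizukiFrdI2008, Thm. 3.4 (iv) p.63] -/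
theorem preservesDegFr_ofFunctor (hF₁ : PreFrobenioid.IsFrobenioid F₁)
    (hF₂ : PreFrobenioid.IsFrobenioid F₂) (Ψ : C₁ ≌ C₂)
    (h₁₂ : PreservesMor Ψ.functor (ofFunctor Φ₁ F₁).IsPreStep (ofFunctor Φ₂ F₂).IsPreStep)
    (h₂₁ : PreservesMor Ψ.inverse (ofFunctor Φ₂ F₂).IsPreStep (ofFunctor Φ₁ F₁).IsPreStep)
    (hG : PreservesObj Ψ.functor (ofFunctor Φ₁ F₁).IsGroupLikeObj (ofFunctor Φ₂ F₂).IsGroupLikeObj)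
    (hG' : PreservesObj Ψ.inverse (ofFunctor Φ₂ F₂).IsGroupLikeObj (ofFunctor Φ₁ F₁).IsGroupLikeObj)
    (hs₁ : (ofFunctor Φ₁ F₁).IsOfStandardType) (hs₂ : (ofFunctor Φ₂ F₂).IsOfStandardType)
    (hB : (ofFunctor Φ₁ F₁).HypB (ofFunctor Φ₂ F₂) Ψ)
    (hU : ∀ (A : C₁) (α : Aut A), α ∈ (ofFunctor Φ₁ F₁).unitsSubgroup A →
      Ψ.functor.mapIso α ∈ (ofFunctor Φ₂ F₂).unitsSubgroup (Ψ.functor.obj A)) :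
    PreservesDegFr (ofFunctor Φ₁ F₁) (ofFunctor Φ₂ F₂) Ψ := by
  rcases groupLike_dichotomy Ψ hG hG' with ⟨hg₁, hg₂⟩ | ⟨⟨N₁, hN₁⟩, ⟨N₂, hN₂⟩⟩
  · obtain ⟨-, ΨN, hΨN, -⟩ :=
      thm34iii_of_isOfGroupLikeType_of_hypB hF₁ hF₂ hs₁.quasiIsotropic hs₂.quasiIsotropic hg₁ hg₂ Ψ hB
    exact preservesDegFr_ofFunctor_of_isOfGroupLikeType hF₁ hF₂ Ψ hs₁ hs₂ hB hg₁ hg₂ hU ⟨ΨN, hΨN⟩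
  · intro A B φ
    rw [ofFunctor_isGroupLikeObj] at hN₁ hN₂
    exact degFr_map hF₁ hF₂ hs₁.quasiIsotropic hs₂.quasiIsotropic
      (isNonDilatingOn_of_ofFunctor hs₁.nonDilating) (isNonDilatingOn_of_ofFunctor hs₂.nonDilating) Ψ
      (fun A B φ hφ => h₁₂ φ hφ) (fun A B φ hφ => h₂₁ φ hφ) hN₁ hN₂ φ

/-- **Theorem 3.4 (ii) ⟹ the typed `PreFrobenioidData.Thm34iv` (preservation part) modulo its own
first two clauses** ("`Ψ` preserves `O^▷(−)` and `O^×(−)`", hypothesis `h08` in the literal shape of the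
typed conclusion): the third clause `PreservesDegFr` is then a theorem.
[cite: MochizukiFrdI2008, Thm. 3.4 (iv) p.63] -/
theorem thm34iv_ofFunctor_of_units (hF₁ : PreFrobenioid.IsFrobenioid F₁)
    (hF₂ : PreFrobenioid.IsFrobenioid F₂) (Ψ : C₁ ≌ C₂)
    (h₁₂ : PreservesMor Ψ.functor (ofFunctor Φ₁ F₁).IsPreStep (ofFunctor Φ₂ F₂).IsPreStep)
    (h₂₁ : PreservesMor Ψ.inverse (ofFunctor Φ₂ F₂).IsPreStep (ofFunctor Φ₁ F₁).IsPreStep)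
    (hG : PreservesObj Ψ.functor (ofFunctor Φ₁ F₁).IsGroupLikeObj (ofFunctor Φ₂ F₂).IsGroupLikeObj)
    (hG' : PreservesObj Ψ.inverse (ofFunctor Φ₂ F₂).IsGroupLikeObj (ofFunctor Φ₁ F₁).IsGroupLikeObj)
    (h08 : (ofFunctor Φ₁ F₁).IsOfStandardType → (ofFunctor Φ₂ F₂).IsOfStandardType →
      (ofFunctor Φ₁ F₁).HypB (ofFunctor Φ₂ F₂) Ψ → IsFrobeniusSlim D₁ → IsFrobeniusSlim D₂ →
      (∀ (A : C₁) (α : End A), α ∈ (ofFunctor Φ₁ F₁).endSubmonoid A →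
          Ψ.functor.map α ∈ (ofFunctor Φ₂ F₂).endSubmonoid (Ψ.functor.obj A)) ∧
        ∀ (A : C₁) (α : Aut A), α ∈ (ofFunctor Φ₁ F₁).unitsSubgroup A →
          Ψ.functor.mapIso α ∈ (ofFunctor Φ₂ F₂).unitsSubgroup (Ψ.functor.obj A)) :
    (ofFunctor Φ₁ F₁).Thm34iv (ofFunctor Φ₂ F₂) Ψ := fun hs₁ hs₂ hB hsl₁ hsl₂ =>
  ⟨(h08 hs₁ hs₂ hB hsl₁ hsl₂).1, (h08 hs₁ hs₂ hB hsl₁ hsl₂).2,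
    preservesDegFr_ofFunctor hF₁ hF₂ Ψ h₁₂ h₂₁ hG hG' hs₁ hs₂ hB (h08 hs₁ hs₂ hB hsl₁ hsl₂).2⟩

end OfPreSteps

/-! ### Over bases of FSMFF-type in the author's revised (2024) sense -/

/-- **Theorem 3.4 (iii) AS TYPED (`PreFrobenioidData.Thm34iii`) holds for Frobenioids over bases of
FSMFF-type in the author's revised sense** (`IsOfFSMFFType2024`; in particular over bases of FSM-type):
(a) standard type, (b) `HypB` ⟹ the seven preservation clauses and the automorphism `Ψ^{ℕ≥1}` (the
identity as soon as non-group-like objects exist). Thm. 3.4 (ii) enters as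
`FrdI.thm34ii_of_isOfFSMFFType2024` for `Ψ` and `Ψ⁻¹`.
[cite: MochizukiFrdI2008, Thm. 3.4 (iii) p.62] [cite: MochizukiFrdIComments2024, (28) p.3] -/
theorem thm34iii_ofFunctor_of_isOfFSMFFType2024 (hF₁ : PreFrobenioid.IsFrobenioid F₁)
    (hF₂ : PreFrobenioid.IsFrobenioid F₂) (hD₁ : IsOfFSMFFType2024 D₁) (hD₂ : IsOfFSMFFType2024 D₂)
    (Ψ : C₁ ≌ C₂) : (ofFunctor Φ₁ F₁).Thm34iii (ofFunctor Φ₂ F₂) Ψ := fun hs₁ hs₂ hB => by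
  obtain ⟨h₁₂, -, hG⟩ := thm34ii_of_isOfFSMFFType2024 hF₁ hF₂ hs₁.quasiIsotropic hs₂.quasiIsotropic
    hD₁ hD₂ Ψ
  obtain ⟨h₂₁, -, hG'⟩ := thm34ii_of_isOfFSMFFType2024 hF₂ hF₁ hs₂.quasiIsotropic hs₁.quasiIsotropic
    hD₂ hD₁ Ψ.symm
  exact OfPreSteps.thm34iii_ofFunctor hF₁ hF₂ Ψ h₁₂ h₂₁ hG hG' hs₁ hs₂ hB

/-- The same for `Ψ⁻¹` (the shape in which consumers usually need hypothesis (b) for "some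
quasi-inverse"). [cite: MochizukiFrdI2008, Thm. 3.4 (iii) p.62] -/
theorem thm34iii_ofFunctor_symm_of_isOfFSMFFType2024 (hF₁ : PreFrobenioid.IsFrobenioid F₁)
    (hF₂ : PreFrobenioid.IsFrobenioid F₂) (hD₁ : IsOfFSMFFType2024 D₁) (hD₂ : IsOfFSMFFType2024 D₂)
    (Ψ : C₁ ≌ C₂) : (ofFunctor Φ₂ F₂).Thm34iii (ofFunctor Φ₁ F₁) Ψ.symm :=
  thm34iii_ofFunctor_of_isOfFSMFFType2024 hF₂ hF₁ hD₂ hD₁ Ψ.symm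

/-- **Theorem 3.4 (iv), the clause "`Ψ^{ℕ≥1}` is the identity", over bases of FSMFF-type in the revised
sense, modulo the clause "`Ψ` preserves `O^×(−)`" of the same theorem** (`hU`): under (a) standard type
and (b) `HypB`, `Ψ` preserves all Frobenius degrees.
[cite: MochizukiFrdI2008, Thm. 3.4 (iv) p.63] [cite: MochizukiFrdIComments2024, (28) p.3] -/
theorem preservesDegFr_ofFunctor_of_isOfFSMFFType2024 (hF₁ : PreFrobenioid.IsFrobenioid F₁)
    (hF₂ : PreFrobenioid.IsFrobenioid F₂) (hD₁ : IsOfFSMFFType2024 D₁) (hD₂ : IsOfFSMFFType2024 D₂)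
    (Ψ : C₁ ≌ C₂) (hs₁ : (ofFunctor Φ₁ F₁).IsOfStandardType) (hs₂ : (ofFunctor Φ₂ F₂).IsOfStandardType)
    (hB : (ofFunctor Φ₁ F₁).HypB (ofFunctor Φ₂ F₂) Ψ)
    (hU : ∀ (A : C₁) (α : Aut A), α ∈ (ofFunctor Φ₁ F₁).unitsSubgroup A →
      Ψ.functor.mapIso α ∈ (ofFunctor Φ₂ F₂).unitsSubgroup (Ψ.functor.obj A)) :
    PreservesDegFr (ofFunctor Φ₁ F₁) (ofFunctor Φ₂ F₂) Ψ := by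
  obtain ⟨h₁₂, -, hG⟩ := thm34ii_of_isOfFSMFFType2024 hF₁ hF₂ hs₁.quasiIsotropic hs₂.quasiIsotropic
    hD₁ hD₂ Ψ
  obtain ⟨h₂₁, -, hG'⟩ := thm34ii_of_isOfFSMFFType2024 hF₂ hF₁ hs₂.quasiIsotropic hs₁.quasiIsotropic
    hD₂ hD₁ Ψ.symm
  exact OfPreSteps.preservesDegFr_ofFunctor hF₁ hF₂ Ψ h₁₂ h₂₁ hG hG' hs₁ hs₂ hB hU

/-- **The typed `PreFrobenioidData.Thm34iv` (preservation part) over bases of FSMFF-type in the revised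
sense, modulo its own first two clauses** ("`Ψ` preserves `O^▷(−)` and `O^×(−)`", hypothesis `h08`).
[cite: MochizukiFrdI2008, Thm. 3.4 (iv) p.63] [cite: MochizukiFrdIComments2024, (28) p.3] -/
theorem thm34iv_ofFunctor_of_isOfFSMFFType2024_of_units (hF₁ : PreFrobenioid.IsFrobenioid F₁)
    (hF₂ : PreFrobenioid.IsFrobenioid F₂) (hD₁ : IsOfFSMFFType2024 D₁) (hD₂ : IsOfFSMFFType2024 D₂)
    (Ψ : C₁ ≌ C₂)
    (h08 : (ofFunctor Φ₁ F₁).IsOfStandardType → (ofFunctor Φ₂ F₂).IsOfStandardType →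
      (ofFunctor Φ₁ F₁).HypB (ofFunctor Φ₂ F₂) Ψ → IsFrobeniusSlim D₁ → IsFrobeniusSlim D₂ →
      (∀ (A : C₁) (α : End A), α ∈ (ofFunctor Φ₁ F₁).endSubmonoid A →
          Ψ.functor.map α ∈ (ofFunctor Φ₂ F₂).endSubmonoid (Ψ.functor.obj A)) ∧
        ∀ (A : C₁) (α : Aut A), α ∈ (ofFunctor Φ₁ F₁).unitsSubgroup A →
          Ψ.functor.mapIso α ∈ (ofFunctor Φ₂ F₂).unitsSubgroup (Ψ.functor.obj A)) :
    (ofFunctor Φ₁ F₁).Thm34iv (ofFunctor Φ₂ F₂) Ψ := fun hs₁ hs₂ hB hsl₁ hsl₂ =>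
  ⟨(h08 hs₁ hs₂ hB hsl₁ hsl₂).1, (h08 hs₁ hs₂ hB hsl₁ hsl₂).2,
    preservesDegFr_ofFunctor_of_isOfFSMFFType2024 hF₁ hF₂ hD₁ hD₂ Ψ hs₁ hs₂ hB (h08 hs₁ hs₂ hB hsl₁ hsl₂).2⟩

end FrdI

end Literature.AlgebraicGeometry.Frobenioids
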